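import Literature.MathematicalPhysics.QuantumFieldTheory.Balaban1983to89.B9Ineq385VG

/-!
# `Balaban1983to89.B9Ineq383SupForm` — B9 p. 407 (3.83) IN ITS PRINTED SUPREMUM FORM «|(P₂(A)A′)(b)| ≦ O(1)α₁(Lʲη)⁻²|A′|»
# for the printed `P₂(A) = −(F₂*(A)aQ(U) + Q*(U)aF₂(A) + F₂*(A)aF₂(A))`, read off the block-majorant form `B9Ineq385VG.ineq383_op`

HONEST FRAMING (cell `lit-balaban`, verbatim): statement-level skeleton of published theorems with citation tags; proofs
where landed; nothing here is a claim about the Yang–Mills mass gap.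

CITATION HEADER (lean-in-tree rule).  T. Bałaban, *Propagators for lattice gauge theories in a background field*, Commun.
Math. Phys. **99** (1985) 389–434 [`Balaban1985BackgroundPropagators`] (cell paper B9; journal page = PDF page + 388):
p. 407 [PDF 19] (3.82)–(3.84) with the sentences between them; p. 406 [PDF 18] (3.78)–(3.81); p. 394–395 [PDF 6–7] (3.24),
(3.26); [4] = T. Bałaban, *Propagators and renormalization transformations for lattice gauge theories. II*, Commun. Math.
Phys. **96** (1984) 223–250 [`Balaban1984PropagatorsII`], (2.51)–(2.52) p. 232, Lemma 2.1 (2.61) p. 234.  Text read from the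
held text layer (`lit read paper:balaban1985-cmp99-background-propagators`, page p0019 = p. 407, p0018 = p. 406) and the
render `b2b-balaban-ref1/pages/1985-cmp99-background-propagators/…-p019-x2.png` READ AS IMAGE by this seat.  Cell `lit-balaban`
seat r06 gen 26 (B9 fold owner), SKELETON row `B9.Eq3.82` (p. 407 (3.82)–(3.84)); continuation of this seat's gen-7 file
`B9Ineq385VG` (§1 `ineq383_op` = (3.83) in the block-majorant (operator) form of [4] (2.51); §3 `supBound_of_hasMajorant`,
`rowSum_of_ineq261` — all USED BY NAME, nothing re-proved).

WHAT IS PRINTED («…» verbatim, p. 407, after (3.82)).  «The operator P₂(A) is a sum of three terms obtained by the expansion of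
averaging operators. It is a semi-local operator in the sense that the value (P₂(A)A′)(b) at a bond b ∈ Bʲ(Λ_j) depends on
A, A′ restricted to j-blocks neighbouring the block containing the bond b. It satisfies the bound

  |(P₂(A)A′)(b)| ≦ O(1)α₁(Lʲη)⁻²|A′|,  b ∈ Bʲ(Λ_j),   (3.83)

with the norm |A′| restricted to the blocks defined above.»  (3.82) p. 407: «Δ_a(U′U) = … = Δ_a(U) − V₃(A) − P₁(A) − P₂(A)»,
the third line of the display giving `P₂(A) = −(F₂*(A)aQ(U) + Q*(U)aF₂(A) + F₂*(A)aF₂(A))` (typed with this body as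
`B9Eq386Neumann.pTwo`).  p. 406 (3.81): «|F_{2,j}(A)A′| ≦ … ≦ O(1)α₁Q″_j|A′| on Λ_j» and «Q*_j(U′U) = Q*_j(U) + F*_{2,j}(A), and
F*_{2,j}(A) satisfies (3.81)».

WHAT THIS FILE PROVES (theorems only; 0 `def`, 0 `Prop` placeholders, 0 new facts; standard axioms; v1.1 (r06 gen 26) = DOCFIX ONLY —
the render p019-x2.png re-read: «b ∈ Bʲ(Λ_j)» (superscript j) for the text layer's «B_j(Λ_j)» in the (3.83) quotations, and «P₁(A),»
restored in the SCOPE (v) quotation «The operators V₃(A), P₁(A), P₂(A) depend analytically on A» (the text layer p0019 L14/L15 drops the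
token; the same LB-DROP as Q-FID row QF57-002 on `B9Ineq385VG`); declarations byte-identical to v1 p374545).  SETTING = `B9Ineq385VG`
§1/§3: pv08's `B6RandomWalk.HasMajorant` over `B9Thm34Ext.toB6`, all letters in ONE `Module.End ℝ (W → ℝ)` with block map
`blk : W → 𝔅` (`W` = the bond-and-component carrier; `𝔅` = the multiscale block set with `len y = Lʲη` for `y ∈ Λ_j` and the
distance `d(y,y′)` of [4] (2.46)).
* §1 **`supBound_blockwise_of_hasMajorant`** — the BLOCKWISE form of [4] (2.51)–(2.52) for an arbitrary (not block-supported)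
  argument: if `T ≺ K` and `|μ| ≦ B(y′)` on the block `Δ(y′)` for every `y′` (`B ≧ 0`), then `|(Tμ)(x)| ≦ Σ_{y′∈𝔅} K(y,y′)B(y′)`
  for `x ∈ Δ(y)` (decompose `μ = Σ_{y′}Δ(y′)μ` and add; `B9Ineq385VG.supBound_of_hasMajorant` is the case `B ≡ const`).
* §2 **`ineq383_sup`** — **(3.83) AS PRINTED**: under EXACTLY the hypotheses of `B9Ineq385VG.ineq383_op` (the (3.19)/(3.81)-
  shaped block majorants of the letters `Q = Q_j(U)`, `Q* = Q*_j(U)` (`κ_Qe^{−δd}`), `F₂ = F_{2,j}(A)`, `F₂* = F*_{2,j}(A)`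
  (`c_Fα₁e^{−δd}`), the diagonal weight letter `a ≺ ā(Lʲη)⁻²𝟙[y = y′]` of (3.24)/(3.26), the scale transfer of `(Lʲη)⁻²`, [4]
  (2.61) at `β` and (2.54)) plus the row sum `Σ_{y′}e^{−ρd(y,y′)} ≦ C_ρ` ([4] (2.61) at the output rate `ρ`): for EVERY bounded
  `A′` (`|A′| ≦ B` everywhere) and every `x ∈ Δ(y)`, `y ∈ Λ_j`,
  `|(P₂(A)A′)(x)| ≦ κ₃₈₃·C_ρ·α₁·(Lʲη)⁻²·B` — the printed «O(1)α₁(Lʲη)⁻²|A′|» with **O(1) = κ₃₈₃C_ρ EXPLICIT**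
  (`κ₃₈₃ = āΛc₁(β)c_F(2κ_Q + c_Fα₁)` of `B9Ineq385VG.kappa383`); **`ineq383_sup_of_261`** — the same with `ρ = γδ₀` and `C_ρ =
  c₁(γ)` supplied by [4] Lemma 2.1 (2.61) (`B6RandomWalk.Ineq261`).
* §3 **`ineq383_sup_blockwise`** — the SEMI-LOCAL (weighted) form carrying «with the norm |A′| restricted to the blocks defined
  above»: `|(P₂(A)A′)(x)| ≦ κ₃₈₃α₁(Lʲη)⁻²·Σ_{y′}e^{−ρd(y,y′)}·sup_{Δ(y′)}|A′|` for blockwise bounds `sup_{Δ(y′)}|A′| ≦ B(y′)`.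

SCOPE / NOT CLAIMED.  (i) LETTERS BY REFERENCE: `Q_j(U)`, `Q*_j(U)` ((3.13)–(3.15), (3.78); rows B9.Eq3.13 / B9.Eq3.78 of the
cell's ROWS-B9) and `F_{2,j}(A)`, `F*_{2,j}(A)` ((3.80)–(3.81); row B9.Eq3.78) enter through block-majorant HYPOTHESES of the
printed shape, exactly as in `B9Ineq385VG.ineq383_op`; print's instances of these letters live in the tree on other carriers
([5]'s ℤᵈ lattice: `B7Eq78Linearization`, `B7Prop4GeneralLevels`, `B9Eq357Levels`, `B9Eq380Telescope`; the periodic NE9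
carrier: `B9Eq315QTorus`, `B9Eq315QLipschitz`, `B9Eq383QSemiLocal`) and are NOT instantiated on this block carrier here (the
cell's located seam INTERFACES-r06 §5 / B9-CLOSURE §5 (S2)).  (ii) READING of «with the norm |A′| restricted to the blocks
defined above»: in print the letters have finite block range, so `(P₂(A)A′)(b)` sees `A′` on a finite block neighbourhood; the
dressed majorants `κ_Qe^{−δd}`, `c_Fα₁e^{−δd}` of the tree's letters allow exponential tails, under which the restriction is
rendered as the `e^{−ρd(y,y′)}`-WEIGHTED blockwise supremum of §3 (for finite-range letters this IS a finite block
neighbourhood); §2's global-supremum form is implied by the printed one.  One reading, located; no claim either way about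
print's intended neighbourhood.  (iii) `O(1)` = `κ₃₈₃C_ρ` depends on the letters' O(1)'s, `ā`, the scale-transfer constant and
[4]'s `c₁` only — print: the O(1) of (3.81) «depending on d and L only».  (iv) Rates: `ρ ≧ 0` is any rate with `ρ + (α+β)δ₀ ≦ δ`
below the letters' common rate `δ` (print's re-defined-constants convention p. 403, cf. `B9Ineq349.rates_349`).  (v) NOT here:
the semi-locality SENTENCE as a support statement (a prose claim; for the one-step torus averaging it is
`B9Eq383QSemiLocal.QtorusLin_congr_local`), the analyticity sentence («The operators V₃(A), P₁(A), P₂(A) depend analytically on A» — at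
the ring-letter level `B9Eq361VprimeAnalytic.analyticAt_pTwo`; for `V₃` pv27's `B9Eq373V3Analytic`), (3.82)/(3.84) (ring
identities `B9Eq386Neumann.eq382`, `eq384_sub`, `eq384_factor`), (3.85)–(3.86) (`B9Ineq385VG` §2–§6).  Value = the display
(3.83) kernel-checked in the form print writes it, with its O(1) explicit, for print's own `P₂(A)`; NOT summit progress.

RELATED IN THE TREE, NOT DUPLICATED (searched 2026-08-24: `ls Balaban1983to89/ | grep 383` = `B9Eq383QSemiLocal` (torus
one-step `Q` support statement, other carrier), `B16PrepFactorsLargest383` (paper B16, unrelated); `grep -rln ineq383_op` = users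
`B9Ineq346L2SecondDiff(Uniform)`, `B9Thm34GConcreteC`, `B9Thm34GFinal`, `B9Thm34GKernel(Uniform)`, `B9Thm34GUniform`,
`B9Thm34HolderInputG(Uniform)`, `B9Thm34HolderAll{Final,Uniform}` (all consume the MAJORANT form) and the docstrings of
`B9Eq352GradLetters`, `B9Eq360VprimeLetters`; `B9Ineq385VG` §3
`supBound_of_hasMajorant`/`supNorm_VG_le` give the supremum form for `V(A)G(U)` ((3.85) ⇒ «|V(A)G(U)J| ≦ O(1)α₁|J|»), not for
`P₂(A)`).  Nothing in the tree states (3.83) in its printed supremum form.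
-/

noncomputable section

namespace Literature.MathematicalPhysics.QuantumFieldTheory.Balaban1983to89.B9Ineq383SupForm

open Literature.MathematicalPhysics.QuantumFieldTheory.Balaban1983to89
open Literature.MathematicalPhysics.QuantumFieldTheory.Balaban1983to89.B6RandomWalk (HasMajorant BlockSupp Triangle254
  Ineq261 blockPiece sum_blockPiece blockSupp_blockPiece)
open Literature.MathematicalPhysics.QuantumFieldTheory.Balaban1983to89.B9Thm34Ext (toB6)
open Literature.MathematicalPhysics.QuantumFieldTheory.Balaban1983to89.B9Ineq347 (ScaleTransfer)
open Literature.MathematicalPhysics.QuantumFieldTheory.Balaban1983to89.B9Eq386Neumann (pTwo)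
open Literature.MathematicalPhysics.QuantumFieldTheory.Balaban1983to89.B9Ineq385VG (kappa383 kappa383_nonneg ineq383_op
  supBound_of_hasMajorant rowSum_of_ineq261)

/-! ## §1  [4] (2.51)–(2.52) for an arbitrary argument, blockwise -/

section Blockwise

variable {g : B9.Geometry} [Fintype g.Site] {R : ℝ} {H : Prop} {W : Type}

/-- **From a (2.51)-majorant to a blockwise bound for an arbitrary argument**: if `T ≺ K` and `|μ(x′)| ≦ B(y′)` for `x′ ∈
Δ(y′)`, every `y′ ∈ 𝔅` (`B ≧ 0`), then `|(Tμ)(x)| ≦ Σ_{y′∈𝔅} K(y,y′)·B(y′)` for `x ∈ Δ(y)` — decompose `μ = Σ_{y′}Δ(y′)μ` ([4]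
(2.52)) and add the block bounds (2.51). [cite: Balaban1984PropagatorsII, (2.51)–(2.52) p.232] -/
theorem supBound_blockwise_of_hasMajorant (blk : W → g.Site) {T : Module.End ℝ (W → ℝ)} {K : g.Site → g.Site → ℝ}
    (h : HasMajorant (g := toB6 g R H) blk T K) (μ : W → ℝ) (B : g.Site → ℝ) (hB : ∀ y', 0 ≤ B y')
    (hμ : ∀ x', |μ x'| ≤ B (blk x')) (x : W) : |T μ x| ≤ ∑ y' : g.Site, K (blk x) y' * B y' := by
  classical
  have hpiece : ∀ y' : g.Site, |T (blockPiece (g := toB6 g R H) blk y' μ) x| ≤ K (blk x) y' * B y' := fun y' =>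
    h y' _ _ (blockSupp_blockPiece (g := toB6 g R H) blk μ y' (B y') (hB y') (fun x' hx' => hx' ▸ hμ x')) x
  have hdec : T μ x = ∑ y' : g.Site, T (blockPiece (g := toB6 g R H) blk y' μ) x := by
    conv_lhs => rw [← sum_blockPiece (g := toB6 g R H) blk μ]
    rw [map_sum, Finset.sum_apply]
    rfl
  rw [hdec]
  exact (Finset.abs_sum_le_sum_abs _ _).trans (Finset.sum_le_sum fun y' _ => hpiece y')

end Blockwise

/-! ## §2  (3.83) as printed: «|(P₂(A)A′)(b)| ≦ O(1)α₁(Lʲη)⁻²|A′|, b ∈ Bʲ(Λ_j)» -/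

section Printed

variable {g : B9.Geometry} [Fintype g.Site] [DecidableEq g.Site] {R : ℝ} {H : Prop} {W : Type}

/-- **(3.83) p. 407 AS PRINTED — «It satisfies the bound |(P₂(A)A′)(b)| ≦ O(1)α₁(Lʲη)⁻²|A′|, b ∈ Bʲ(Λ_j), (3.83)»**, for the
PRINTED `P₂(A) = B9Eq386Neumann.pTwo Qs Q F₂ F₂s a = −(F₂*(A)aQ(U) + Q*(U)aF₂(A) + F₂*(A)aF₂(A))` ((3.82), third line).
INPUTS: exactly those of `B9Ineq385VG.ineq383_op` — `Q`, `Q* ≺ κ_Qe^{−δd}` (the bounded semi-local averaging letters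
(3.15)/(3.78)), `F₂`, `F₂* ≺ c_Fα₁e^{−δd}` ((3.81) and «F*_{2,j}(A) satisfies (3.81)»), `a ≺ ā(Lʲη)⁻²𝟙[y = y′]` ((3.24)/(3.26)),
the scale transfer of `(Lʲη)⁻²` (constant `Λ`), [4] (2.61) at `β`, (2.54), `d ≧ 0`, a rate `ρ ≧ 0` with `ρ + (α+β)δ₀ ≦ δ` — PLUS
the row sum `Σ_{y′}e^{−ρd(y,y′)} ≦ C_ρ` ([4] (2.61) at the rate `ρ`).  CONCLUSION: for every `A′` with `|A′| ≦ B` everywhere and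
every `x` (in the block `Δ(y)`, `y = blk x ∈ Λ_j`, `len y = Lʲη`):
`|(P₂(A)A′)(x)| ≦ κ₃₈₃·C_ρ·α₁·(Lʲη)⁻²·B`, i.e. the printed bound with `O(1) = κ₃₈₃C_ρ` explicit.
[cite: Balaban1985BackgroundPropagators, (3.83) p.407 + (3.82) p.407 + (3.81) p.406 + (3.24) p.394; Balaban1984PropagatorsII, (2.51)–(2.52) p.232 + Lemma 2.1 (2.61) p.234] -/
theorem ineq383_sup (blk : W → g.Site) (d : ℕ) (δ₀ δ α β ρ Λ κQ cF abar α₁ Cρ : ℝ)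
    (hκQ : 0 ≤ κQ) (hcF : 0 ≤ cF) (habar : 0 ≤ abar) (hα₁ : 0 ≤ α₁) (hΛ : 0 ≤ Λ) (hρ : 0 ≤ ρ) (hα : 0 ≤ α)
    (hβ : 0 ≤ β) (hδ₀ : 0 ≤ δ₀) (hr : ρ + (α + β) * δ₀ ≤ δ)
    (hdnn : ∀ a b : g.Site, 0 ≤ g.dist a b) (htri : Triangle254 (toB6 g R H))
    (h261 : Ineq261 d (toB6 g R H) δ₀ β) (hT2i : ScaleTransfer g δ₀ α Λ (fun a => (g.len a ^ 2)⁻¹))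
    (hsum : ∀ y : g.Site, ∑ y' : g.Site, Real.exp (-(ρ * g.dist y y')) ≤ Cρ)
    {Qs Q F₂ F₂s Aop : Module.End ℝ (W → ℝ)}
    (hQ : HasMajorant (g := toB6 g R H) blk Q (fun a b => κQ * Real.exp (-(δ * g.dist a b))))
    (hQs : HasMajorant (g := toB6 g R H) blk Qs (fun a b => κQ * Real.exp (-(δ * g.dist a b))))
    (hF : HasMajorant (g := toB6 g R H) blk F₂ (fun a b => cF * α₁ * Real.exp (-(δ * g.dist a b))))
    (hFs : HasMajorant (g := toB6 g R H) blk F₂s (fun a b => cF * α₁ * Real.exp (-(δ * g.dist a b))))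
    (hA : HasMajorant (g := toB6 g R H) blk Aop (fun a b : g.Site => if a = b then abar * (g.len a ^ 2)⁻¹ else 0))
    (A' : W → ℝ) (B : ℝ) (hB : 0 ≤ B) (hA' : ∀ x, |A' x| ≤ B) (x : W) :
    |pTwo Qs Q F₂ F₂s Aop A' x|
      ≤ kappa383 κQ cF abar Λ (B6.c1 d δ₀ β) α₁ * Cρ * α₁ * (g.len (blk x) ^ 2)⁻¹ * B := by
  have h383 := ineq383_op (R := R) (H := H) blk d δ₀ δ α β ρ Λ κQ cF abar α₁ hκQ hcF habar hα₁ hΛ hρ hα hβ hδ₀ hr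
    hdnn htri h261 hT2i hQ hQs hF hFs hA
  have h1 := supBound_of_hasMajorant (R := R) (H := H) blk h383 A' B hB hA' x
  refine h1.trans ?_
  have hκ : 0 ≤ kappa383 κQ cF abar Λ (B6.c1 d δ₀ β) α₁ :=
    kappa383_nonneg hκQ hcF habar hΛ (B6RandomWalk.c1_nonneg d δ₀ β) hα₁
  have hℓ : 0 ≤ (g.len (blk x) ^ 2)⁻¹ := inv_nonneg.mpr (sq_nonneg _)
  have hc : 0 ≤ kappa383 κQ cF abar Λ (B6.c1 d δ₀ β) α₁ * α₁ * (g.len (blk x) ^ 2)⁻¹ :=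
    mul_nonneg (mul_nonneg hκ hα₁) hℓ
  rw [← Finset.mul_sum]
  calc kappa383 κQ cF abar Λ (B6.c1 d δ₀ β) α₁ * α₁ * (g.len (blk x) ^ 2)⁻¹ *
        (∑ y' : g.Site, Real.exp (-(ρ * g.dist (blk x) y'))) * B
      ≤ kappa383 κQ cF abar Λ (B6.c1 d δ₀ β) α₁ * α₁ * (g.len (blk x) ^ 2)⁻¹ * Cρ * B :=
        mul_le_mul_of_nonneg_right (mul_le_mul_of_nonneg_left (hsum (blk x)) hc) hB
    _ = kappa383 κQ cF abar Λ (B6.c1 d δ₀ β) α₁ * Cρ * α₁ * (g.len (blk x) ^ 2)⁻¹ * B := by ring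

/-- **(3.83) AS PRINTED with [4] Lemma 2.1 supplying the row sum**: the output rate `ρ = γδ₀` (`γ ≧ 0`, `γδ₀ + (α+β)δ₀ ≦ δ`)
and (2.61) at the exponent `γ` give `C_ρ = c₁(γ)`, so `|(P₂(A)A′)(x)| ≦ κ₃₈₃·c₁(γ)·α₁·(Lʲη)⁻²·sup|A′|`.
[cite: Balaban1985BackgroundPropagators, (3.83) p.407; Balaban1984PropagatorsII, Lemma 2.1 (2.61) p.234] -/
theorem ineq383_sup_of_261 (blk : W → g.Site) (d : ℕ) (δ₀ δ α β γ Λ κQ cF abar α₁ : ℝ)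
    (hκQ : 0 ≤ κQ) (hcF : 0 ≤ cF) (habar : 0 ≤ abar) (hα₁ : 0 ≤ α₁) (hΛ : 0 ≤ Λ) (hγ : 0 ≤ γ) (hα : 0 ≤ α)
    (hβ : 0 ≤ β) (hδ₀ : 0 ≤ δ₀) (hr : γ * δ₀ + (α + β) * δ₀ ≤ δ)
    (hdnn : ∀ a b : g.Site, 0 ≤ g.dist a b) (htri : Triangle254 (toB6 g R H))
    (h261 : Ineq261 d (toB6 g R H) δ₀ β) (h261γ : Ineq261 d (toB6 g R H) δ₀ γ)
    (hT2i : ScaleTransfer g δ₀ α Λ (fun a => (g.len a ^ 2)⁻¹))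
    {Qs Q F₂ F₂s Aop : Module.End ℝ (W → ℝ)}
    (hQ : HasMajorant (g := toB6 g R H) blk Q (fun a b => κQ * Real.exp (-(δ * g.dist a b))))
    (hQs : HasMajorant (g := toB6 g R H) blk Qs (fun a b => κQ * Real.exp (-(δ * g.dist a b))))
    (hF : HasMajorant (g := toB6 g R H) blk F₂ (fun a b => cF * α₁ * Real.exp (-(δ * g.dist a b))))
    (hFs : HasMajorant (g := toB6 g R H) blk F₂s (fun a b => cF * α₁ * Real.exp (-(δ * g.dist a b))))
    (hA : HasMajorant (g := toB6 g R H) blk Aop (fun a b : g.Site => if a = b then abar * (g.len a ^ 2)⁻¹ else 0))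
    (A' : W → ℝ) (B : ℝ) (hB : 0 ≤ B) (hA' : ∀ x, |A' x| ≤ B) (x : W) :
    |pTwo Qs Q F₂ F₂s Aop A' x|
      ≤ kappa383 κQ cF abar Λ (B6.c1 d δ₀ β) α₁ * B6.c1 d δ₀ γ * α₁ * (g.len (blk x) ^ 2)⁻¹ * B := by
  have hsum : ∀ y : g.Site, ∑ y' : g.Site, Real.exp (-(γ * δ₀ * g.dist y y')) ≤ B6.c1 d δ₀ γ :=
    rowSum_of_ineq261 (R := R) (H := H) d δ₀ γ h261γ
  exact ineq383_sup (R := R) (H := H) blk d δ₀ δ α β (γ * δ₀) Λ κQ cF abar α₁ (B6.c1 d δ₀ γ) hκQ hcF habar hα₁ hΛ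
    (mul_nonneg hγ hδ₀) hα hβ hδ₀ hr hdnn htri h261 hT2i hsum hQ hQs hF hFs hA A' B hB hA' x

end Printed

/-! ## §3  «with the norm |A′| restricted to the blocks defined above» — the weighted blockwise form -/

section Blocks

variable {g : B9.Geometry} [Fintype g.Site] [DecidableEq g.Site] {R : ℝ} {H : Prop} {W : Type}

/-- **(3.83), SEMI-LOCAL (blockwise) form** — «It is a semi-local operator in the sense that the value (P₂(A)A′)(b) at a bond
b ∈ Bʲ(Λ_j) depends on A, A′ restricted to j-blocks neighbouring the block containing the bond b … with the norm |A′|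
restricted to the blocks defined above»: under the hypotheses of `B9Ineq385VG.ineq383_op`, for blockwise bounds
`|A′(x′)| ≦ B(y′)` on `Δ(y′)` (`B ≧ 0`) and `x ∈ Δ(y)`,
`|(P₂(A)A′)(x)| ≦ κ₃₈₃·α₁·(Lʲη)⁻²·Σ_{y′∈𝔅} e^{−ρd(y,y′)}·B(y′)` — the blocks enter with the weights `e^{−ρd(y,y′)}` (READING of
the printed restriction under the tree's dressed letters; for finite-range letters a finite block neighbourhood).
[cite: Balaban1985BackgroundPropagators, (3.83) p.407 with the sentence before it; Balaban1984PropagatorsII, (2.51)–(2.52) p.232] -/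
theorem ineq383_sup_blockwise (blk : W → g.Site) (d : ℕ) (δ₀ δ α β ρ Λ κQ cF abar α₁ : ℝ)
    (hκQ : 0 ≤ κQ) (hcF : 0 ≤ cF) (habar : 0 ≤ abar) (hα₁ : 0 ≤ α₁) (hΛ : 0 ≤ Λ) (hρ : 0 ≤ ρ) (hα : 0 ≤ α)
    (hβ : 0 ≤ β) (hδ₀ : 0 ≤ δ₀) (hr : ρ + (α + β) * δ₀ ≤ δ)
    (hdnn : ∀ a b : g.Site, 0 ≤ g.dist a b) (htri : Triangle254 (toB6 g R H))
    (h261 : Ineq261 d (toB6 g R H) δ₀ β) (hT2i : ScaleTransfer g δ₀ α Λ (fun a => (g.len a ^ 2)⁻¹))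
    {Qs Q F₂ F₂s Aop : Module.End ℝ (W → ℝ)}
    (hQ : HasMajorant (g := toB6 g R H) blk Q (fun a b => κQ * Real.exp (-(δ * g.dist a b))))
    (hQs : HasMajorant (g := toB6 g R H) blk Qs (fun a b => κQ * Real.exp (-(δ * g.dist a b))))
    (hF : HasMajorant (g := toB6 g R H) blk F₂ (fun a b => cF * α₁ * Real.exp (-(δ * g.dist a b))))
    (hFs : HasMajorant (g := toB6 g R H) blk F₂s (fun a b => cF * α₁ * Real.exp (-(δ * g.dist a b))))
    (hA : HasMajorant (g := toB6 g R H) blk Aop (fun a b : g.Site => if a = b then abar * (g.len a ^ 2)⁻¹ else 0))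
    (A' : W → ℝ) (B : g.Site → ℝ) (hB : ∀ y', 0 ≤ B y') (hA' : ∀ x', |A' x'| ≤ B (blk x')) (x : W) :
    |pTwo Qs Q F₂ F₂s Aop A' x|
      ≤ kappa383 κQ cF abar Λ (B6.c1 d δ₀ β) α₁ * α₁ * (g.len (blk x) ^ 2)⁻¹ *
          ∑ y' : g.Site, Real.exp (-(ρ * g.dist (blk x) y')) * B y' := by
  have h383 := ineq383_op (R := R) (H := H) blk d δ₀ δ α β ρ Λ κQ cF abar α₁ hκQ hcF habar hα₁ hΛ hρ hα hβ hδ₀ hr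
    hdnn htri h261 hT2i hQ hQs hF hFs hA
  have h1 := supBound_blockwise_of_hasMajorant (R := R) (H := H) blk h383 A' B hB hA' x
  refine h1.trans (le_of_eq ?_)
  rw [Finset.mul_sum]
  refine Finset.sum_congr rfl fun y' _ => ?_
  ring

end Blocks

end Literature.MathematicalPhysics.QuantumFieldTheory.Balaban1983to89.B9Ineq383SupForm
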